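import Mathlib
import HarnessLib
import Summits.HubbardSuperconductivity.HubbardSuperconductivity.Theorems.KLProgrammeKLRegimeEngineTowerPartialIncrLevKitF

/-!
# Route `KLProgramme` — crux K3 ENGINE (stmt-HubbardSuperconductivity-20437 `KLRegimeEngineV17F2`), stub (b) v2, THE LEVELS PACKAGE (ℓ), located item
# «(ℓ)-READOUT-F», (R332)(D)(α′) RO-3′ «levels `1 ≤ j < d` from the LEVEL-0 datum by ONE thick block»: layers (b′)/(c′) of the partial-block
# step WITHOUT THE GUARD `2 ≤ d·k` (cell gate-hubbard-kl, seat gate-hubbard-kl-p3 g22; twins of k3c2-p3 g14's `doorSum_partialIncr_le_orientedF9`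
# (…TowerPartialIncrLevOrientedF §2) and `klLevNormOf_partialIncr_le_kit_orientedF9` (…TowerPartialIncrLevKitF), proofs otherwise verbatim)

WHY.  In the partial-block chain (b′) → (c′) → (d′) (`partialIncrLevF_le_kitStep_of_bounds`, p688005) the guard `2 ≤ d·k` enters at ONE place: the fine
talking relation's line constant `9·α` is certified by `card_talking_bgmFat_le_nine`, stated for a fat index `dk − 1 ≥ 1`.  At fat index `0` the whole label
set `SectorLeg (sectorCount 0) = (Fin 2 × Fin 2) × Fin 2` has `8 ≤ 9` elements, so the count holds for EVERY fat index (§1), and the chain runs at every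
`d·k ≥ 1`.  The instance `(d, k) := (1, 1)` is the BLOCK-`0` step of (α′): input `klTowerInput … 1 1 = 𝒱_1[K]` read at `F̃_0 = bgmFatMultiplier … 0`
(the level-`0` datum, arrays `klTowerMeasLev … 1 1` / `klTowerMuLevF … 1 1`), slice `(Λ_j, Λ_1]`, `1 ≤ j`, whose data on the flow frame are p3 g21's
`linkDataBlockZeroF_klEng` (…TowerBlockZeroLinkDataFKlEng).

* §1 `card_talking_bgmFat_le_nine_all` — the talking count `≤ 9` at EVERY fat index;
* §2 **`doorSum_partialIncr_le_orientedF9'`** — (b′) without `2 ≤ dk`;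
* §3 **`klLevNormOf_partialIncr_le_kit_orientedF9'`** — (c′) without `2 ≤ dk`.
Compositions of landed theorems; nothing about the model is asserted beyond them; nothing asserts (ℓ), any stub, K3 or superconductivity.
References: BGM 2006 §2.7 (2.66), (2.70)–(2.71a), §2.8 (2.76)–(2.84), (2.88)–(2.90), (2.96)–(2.98), Lemma 2.5, App. A3–A4 [cite: BenfattoGiulianiMastropietro2006].
-/

noncomputable section

namespace Summit.HubbardSuperconductivity.HubbardSuperconductivity.Theorems.EngineV8

set_option linter.dupNamespace false -- summit = problem name (single-conjunct summit), D-0017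

open Classical
open Real Finset Literature.MathematicalPhysics.QuantumLattice Literature.Probability.LatticeModels GrassmannAlgebra
open Literature.MathematicalPhysics.QuantumLattice.FermiRG Literature.MathematicalPhysics.QuantumLattice.FermiRG.BGM2006Routing
open Summit.HubbardSuperconductivity.HubbardSuperconductivity.Theorems.KLProgrammeLegKernels
open Summit.HubbardSuperconductivity.HubbardSuperconductivity.Theorems.KLRegimeSplit
open Summit.HubbardSuperconductivity.HubbardSuperconductivity.Theorems.KLRegimeWick
open Summit.HubbardSuperconductivity.HubbardSuperconductivity.Theorems.TwoPointAssembly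
open Literature.Probability.LatticeModels.BattleFederbush
open scoped Nat

variable {L M : ℕ} [NeZero L]

/-! ## §1 The talking count at every fat index -/

/-- **At most `9` legs talk to a given leg of the fat family, at EVERY fat index `k`**: for `k ≥ 1` this is `card_talking_bgmFat_le_nine`; at `k = 0` the
whole label set `SectorLeg (sectorCount 0)` has `2·2·2 = 8 ≤ 9` elements. -/
theorem card_talking_bgmFat_le_nine_all {e₀ β μ : ℝ} {Kp : TrigPolyC4v} (k : ℕ) (σ' : SectorLeg (sectorCount k)) :
    ((univ : Finset (SectorLeg (sectorCount k))).filter fun σ : SectorLeg (sectorCount k) =>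
      (∃ q : FreqMomentum L M, bgmFatMultiplier L M e₀ β (nambuXiCT L μ Kp) k σ.1.1 q * bgmFatMultiplier L M e₀ β (nambuXiCT L μ Kp) k σ'.1.1 q ≠ 0) ∧
        σ.1.2 = σ'.1.2 ∧ σ.2 ≠ σ'.2).card ≤ 9 := by
  rcases Nat.eq_zero_or_pos k with rfl | hk
  · refine (card_filter_le _ _).trans ?_
    rw [card_univ]
    simp [sectorCount]
  · exact card_talking_bgmFat_le_nine hk σ'

/-! ## §2 Layer (b′) without the guard -/

section Door

variable [NeZero M]

/-- **THE ORIENTED LEVELLED BLOCK STEP ON `Δ_k`, DOOR FORM, FINE TALKING RELATION (`c = 9`), (I1) DISCHARGED, (I2) PIN-CREDITED, (I3) DISCHARGED IN FLOOR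
UNITS, PARTIAL INCREMENT — WITHOUT THE GUARD `2 ≤ dk`** (twin of `doorSum_partialIncr_le_orientedF9`, p688005's (b′), for EVERY `dk ≥ 1`, so that
`(d, k) := (1, 1)` — block `0` from the level-`0` datum `𝒱_1 @ F̃_0` — is covered); hypotheses and conclusion as in `doorSum_partialIncr_le_orientedF_of_ov` with k3c2-p3's talking relation (common momentum ∧ equal spins ∧
opposite bar indices, `card_talking_bgmFat_le_nine`): line constant `9·α`. -/
theorem doorSum_partialIncr_le_orientedF9' {β : ℝ} (hβ : 0 < β) (U μ : ℝ) (K : TrigPolyC4v) {d k j J' : ℕ} (hd : 1 ≤ d) (hk : 1 ≤ k)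
    (hj : d * k ≤ j)
    (hJ' : d * k ≤ J') (hZ : hubbardEffPartitionFnCT L M β U μ 0 K (klScale klE0 (d * k)) ≠ 0)
    {κ : ℝ} (hκ : 0 < κ)
    (hGB : IsGramBoundedR ((sectorSubMatrix L M β (bgmFatMultiplier L M klE0 β (nambuXiCT L μ K) (d * k - 1))).transpose *
      hubbardCovSliceCT L M β μ 0 K (klScale klE0 j) (klScale klE0 (d * k)) *
        sectorSubMatrix L M β (bgmFatMultiplier L M klE0 β (nambuXiCT L μ K) (d * k - 1))) κ)
    {α : ℝ} (hα : 0 < α)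
    (hrow : ∀ X, ∑ Y, ‖((sectorSubMatrix L M β (bgmFatMultiplier L M klE0 β (nambuXiCT L μ K) (d * k - 1))).transpose *
        hubbardCovSliceCT L M β μ 0 K (klScale klE0 j) (klScale klE0 (d * k)) *
          sectorSubMatrix L M β (bgmFatMultiplier L M klE0 β (nambuXiCT L μ K) (d * k - 1))) X Y‖ ≤ α)
    (hcol : ∀ Y, ∑ X, ‖((sectorSubMatrix L M β (bgmFatMultiplier L M klE0 β (nambuXiCT L μ K) (d * k - 1))).transpose *
        hubbardCovSliceCT L M β μ 0 K (klScale klE0 j) (klScale klE0 (d * k)) *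
          sectorSubMatrix L M β (bgmFatMultiplier L M klE0 β (nambuXiCT L μ K) (d * k - 1))) X Y‖ ≤ α)
    {ρ : ℝ} (hρ : 0 < ρ)
    {cr cc : ℝ} (hcc0 : 0 ≤ cc)
    (hrow' : ∀ X'', ∑ X', ‖(sectorAnalysisMatrix L M β (klAnisoFamily L M β μ K klE0 J') *
        sectorSubMatrix L M β (bgmFatMultiplier L M klE0 β (nambuXiCT L μ K) (d * k - 1))) X'' X'‖ ≤ cr)
    (hcol' : ∀ X', ∑ X'', ‖(sectorAnalysisMatrix L M β (klAnisoFamily L M β μ K klE0 J') *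
        sectorSubMatrix L M β (bgmFatMultiplier L M klE0 β (nambuXiCT L μ K) (d * k - 1))) X'' X'‖ ≤ cc)
    {N₀ : ℕ} (hN₀ : 2 ≤ N₀)
    (hθV : Real.exp 1 * α * normV (SpaceTimeIdx L M × SectorLeg (sectorCount (d * k - 1))) κ ρ
      (fun m' => imagTimeWeight β M * klTowerMeasLev L M β U μ K d k (2 * m') 0) / κ ^ 2 < 1)
    {q : ℕ} (p : Fin (2 * q + 1 + 1)) (J : Finset (Fin (2 * q + 1 + 1))) (hp : p ∉ J)
    (τ'' : Fin (2 * q + 1 + 1) → SectorLeg (sectorCount J')) (w'' : SpaceTimeIdx L M × SectorLeg (sectorCount J')) :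
    ∑ X'' ∈ univ.filter (fun X'' : Fin (2 * q + 1 + 1) → SpaceTimeIdx L M × SectorLeg (sectorCount J') =>
        X'' p = w'' ∧ ∀ j ∈ J, (X'' j).2 = τ'' j),
        ‖kernel ℂ (ExteriorAlgebra.map (Matrix.toLin' (sectorAnalysisMatrix L M β (klAnisoFamily L M β μ K klE0 J')))
          (klEffectiveAction L M β U μ K klE0 j - klTowerInput L M β U μ K d k)) (2 * q + 1 + 1) X''‖ ≤
      cr * cc ^ (2 * q + 1) * ((∏ j ∈ J, (((univ.filter fun ℓ' : SectorLeg (sectorCount (d * k - 1)) =>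
          (∃ q' : FreqMomentum L M, klAnisoFamily L M β μ K klE0 J' (τ'' j).1.1 q' ≠ 0 ∧
            bgmFatMultiplier L M klE0 β (nambuXiCT L μ K) (d * k - 1) ℓ'.1.1 q' ≠ 0) ∧
          ℓ'.1.2 = (τ'' j).1.2 ∧ ℓ'.2 = (τ'' j).2).card : ℕ) : ℝ)) *
        (∑ n ∈ Ico 2 N₀, (κ⁻¹ ^ (2 * q + 1 + 1) * κ⁻¹ ^ (2 * (n - 1)) * ((((9 : ℕ) : ℝ) * α) ^ (n - 1) * Real.exp n)) *
            ∑ δ ∈ (Fintype.piFinset fun _ : Fin n => range (Fintype.card (SpaceTimeIdx L M × SectorLeg (sectorCount (d * k - 1))) / 2 + 1)) with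
                2 * q + 1 + 1 + 2 * (n - 1) ≤ ∑ a, 2 * δ a,
              ∑ pf : J → Fin n, ((∏ j, ((2 * δ (pf j) : ℕ) : ℝ)) / ((∑ a, 2 * δ a : ℕ) : ℝ) ^ J.card) *
                ((Real.exp 3 * κ) ^ (∑ a, 2 * δ a) *
                  ((∏ a, (imagTimeWeight β M * klTowerMuLevF L M β U μ K d k (δ a) * klLevUnitF β M 0 (δ a) (d * k - 1) / 27)) *
                    ((1 / 2 : ℝ) ^ (d * k - 1)) ^ lumps (1 + J.card))) +
          ρ⁻¹ ^ (2 * q + 1 + 1) * (Real.exp 1 * normV (SpaceTimeIdx L M × SectorLeg (sectorCount (d * k - 1))) κ ρ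
              (fun m' => imagTimeWeight β M * klTowerMeasLev L M β U μ K d k (2 * m') 0)) *
            (Real.exp 1 * α * normV (SpaceTimeIdx L M × SectorLeg (sectorCount (d * k - 1))) κ ρ
                (fun m' => imagTimeWeight β M * klTowerMeasLev L M β U μ K d k (2 * m') 0) / κ ^ 2) ^ (N₀ - 1) /
            (1 - Real.exp 1 * α * normV (SpaceTimeIdx L M × SectorLeg (sectorCount (d * k - 1))) κ ρ
                (fun m' => imagTimeWeight β M * klTowerMeasLev L M β U μ K d k (2 * m') 0) / κ ^ 2))) +
      cr * cc ^ (2 * q + 1) *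
        ∑ m' ∈ range (Fintype.card (SpaceTimeIdx L M × SectorLeg (sectorCount (d * k - 1))) / 2 + 1), (if q + 1 < m' then
          ((((2 * (q + 1)).factorial : ℝ))⁻¹ * ((∏ j ∈ univ.filter (fun j : Fin (2 * (q + 1)) => j ∉ J), (2 * m' - (j : ℕ)) : ℕ) : ℝ)) *
            ((2 * m' : ℕ) : ℝ) ^ J.card * κ ^ (2 * m' - 2 * (q + 1)) *
              ((27 : ℝ) ^ J.card * (imagTimeWeight β M *
                (if J.card = 0 then klTowerMeasLev L M β U μ K d k (2 * m') 0 else klTowerMeasLev L M β U μ K d k (2 * m') (J.card + 1))))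
          else 0) := by
  have hβ' : β ≠ 0 := hβ.ne'
  exact doorSum_partialIncr_le_orientedF_of_ov hβ U μ K hd hk hj hJ' hZ
    (fun σ σ' : SectorLeg (sectorCount (d * k - 1)) =>
      (∃ q' : FreqMomentum L M, bgmFatMultiplier L M klE0 β (nambuXiCT L μ K) (d * k - 1) σ.1.1 q' *
          bgmFatMultiplier L M klE0 β (nambuXiCT L μ K) (d * k - 1) σ'.1.1 q' ≠ 0) ∧ σ.1.2 = σ'.1.2 ∧ σ.2 ≠ σ'.2)
    (by norm_num) (fun σ' => card_talking_bgmFat_le_nine_all (L := L) (M := M) (e₀ := klE0) (β := β) (μ := μ) (Kp := K) (d * k - 1) σ')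
    (fun X Y hXY =>
      ⟨talking_of_sectorSub_transpose_covSliceCT_sectorSub_ne_zero hβ' μ K _ _ _ X Y hXY,
        talking_symm _ (talking_of_sectorSub_transpose_covSliceCT_sectorSub_ne_zero hβ' μ K _ _ _ X Y hXY)⟩)
    hκ hGB hα hrow hcol hρ hcc0 hrow' hcol' hN₀ hθV p J hp τ'' w''


end Door

/-! ## §3 Layer (c′) without the guard -/

section Born

variable [NeZero M]

/-- **THE ORIENTED LEVELLED NORMS OF A PARTIAL-BLOCK INCREMENT IN KIT FORM, PIN-CREDITED, FLOOR ARRAYS CONCRETE, EVERY PRESCRIPTION — WITHOUT THE GUARD `2 ≤ dk`** (twin of `klLevNormOf_partialIncr_le_kit_orientedF9`, p688488's (c′)).  `1 ≤ d`, `1 ≤ k`,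
`dk ≤ j`, `dk ≤ J′`, `Z^K_{Λ_{dk}} ≠ 0`; binders as in `klLevNormOf_klTowerIncr_le_kit_orientedF9` with the slice `(Λ_j, Λ_{dk}]`.  Then
`klLevNormOf … J′ (2(q+1)) (𝒱_j − 𝒱_{dk}) Ωe ≤ ε^{2q+1}·(cr·cc^{2q+1}·(27^F·(((1/2)^{dk−1})^{lumps F}·S + T)) + cr·cc^{2q+1}·((e²)^{q+2}/2·towerFO D κ² NF (q+1)))`. -/
theorem klLevNormOf_partialIncr_le_kit_orientedF9' {β : ℝ} (hβ : 0 < β) (U μ : ℝ) (K : TrigPolyC4v) {d k j J' : ℕ} (hd : 1 ≤ d)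
    (hk : 1 ≤ k) (hj : d * k ≤ j) (hJ' : d * k ≤ J') (hZ : hubbardEffPartitionFnCT L M β U μ 0 K (klScale klE0 (d * k)) ≠ 0)
    {κ : ℝ} (hκ : 0 < κ)
    (hGB : IsGramBoundedR ((sectorSubMatrix L M β (bgmFatMultiplier L M klE0 β (nambuXiCT L μ K) (d * k - 1))).transpose *
      hubbardCovSliceCT L M β μ 0 K (klScale klE0 j) (klScale klE0 (d * k)) *
        sectorSubMatrix L M β (bgmFatMultiplier L M klE0 β (nambuXiCT L μ K) (d * k - 1))) κ)
    {α : ℝ} (hα : 0 < α)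
    (hrow : ∀ X, ∑ Y, ‖((sectorSubMatrix L M β (bgmFatMultiplier L M klE0 β (nambuXiCT L μ K) (d * k - 1))).transpose *
        hubbardCovSliceCT L M β μ 0 K (klScale klE0 j) (klScale klE0 (d * k)) *
          sectorSubMatrix L M β (bgmFatMultiplier L M klE0 β (nambuXiCT L μ K) (d * k - 1))) X Y‖ ≤ α)
    (hcol : ∀ Y, ∑ X, ‖((sectorSubMatrix L M β (bgmFatMultiplier L M klE0 β (nambuXiCT L μ K) (d * k - 1))).transpose *
        hubbardCovSliceCT L M β μ 0 K (klScale klE0 j) (klScale klE0 (d * k)) *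
          sectorSubMatrix L M β (bgmFatMultiplier L M klE0 β (nambuXiCT L μ K) (d * k - 1))) X Y‖ ≤ α)
    {ρ : ℝ} (hρ : 0 < ρ)
    {cr cc : ℝ} (hcr0 : 0 ≤ cr) (hcc0 : 0 ≤ cc)
    (hrow' : ∀ X'', ∑ X', ‖(sectorAnalysisMatrix L M β (klAnisoFamily L M β μ K klE0 J') *
        sectorSubMatrix L M β (bgmFatMultiplier L M klE0 β (nambuXiCT L μ K) (d * k - 1))) X'' X'‖ ≤ cr)
    (hcol' : ∀ X', ∑ X'', ‖(sectorAnalysisMatrix L M β (klAnisoFamily L M β μ K klE0 J') *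
        sectorSubMatrix L M β (bgmFatMultiplier L M klE0 β (nambuXiCT L μ K) (d * k - 1))) X'' X'‖ ≤ cc)
    {N₀ : ℕ} (hN₀ : 2 ≤ N₀)
    (q : ℕ) (Ωe : Fin (2 * q + 1 + 1) → Option (SectorLeg (sectorCount J')))
    {Nt : ℕ → ℝ} (hNt0 : ∀ m, 0 ≤ Nt m) (hNt00 : Nt 0 = 0)
    (hNtB : ∀ m, imagTimeWeight β M * klTowerMeasLev L M β U μ K d k (2 * m) 0 ≤ Nt m)
    {NF : ℕ → ℝ} (hNF : ∀ m c, levelCount Ωe ≤ c + 1 → c ≤ levelCount Ωe →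
      (27 : ℝ) ^ c * (imagTimeWeight β M *
        (if c = 0 then klTowerMeasLev L M β U μ K d k (2 * m) 0 else klTowerMeasLev L M β U μ K d k (2 * m) (c + 1))) ≤ NF m)
    {D : ℕ} (hD : Fintype.card (SpaceTimeIdx L M × SectorLeg (sectorCount (d * k - 1))) / 2 ≤ D)
    {τ ψ : ℝ} (hτ1 : (exp 3 * κ) ^ 2 ≤ τ) (hτ2 : (exp 2 * (κ + ρ)) ^ 2 ≤ τ) (hψ1 : κ⁻¹ ^ 2 ≤ ψ) (hψ2 : ρ⁻¹ ^ 2 ≤ ψ)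
    (hguard : exp 1 * (9 * α) / κ ^ 2 * towerV D τ Nt < 1) :
    klLevNormOf L M β μ K J' (2 * q + 1 + 1) (klEffectiveAction L M β U μ K klE0 j - klTowerInput L M β U μ K d k) Ωe ≤
      imagTimeWeight β M ^ (2 * q + 1) *
        (cr * cc ^ (2 * q + 1) * ((27 : ℝ) ^ levelCount Ωe *
            (((1 / 2 : ℝ) ^ (d * k - 1)) ^ lumps (levelCount Ωe) *
                ∑ n ∈ Icc 2 (N₀ - 1), exp 1 * (exp 1 * (9 * α) / κ ^ 2) ^ (n - 1) * ψ ^ (q + 1) *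
                  towerS D τ (fun m : ℕ => imagTimeWeight β M * klTowerMuLevF L M β U μ K d k m * klLevUnitF β M 0 m (d * k - 1) / 27) n (q + 1) +
              ψ ^ (q + 1) * (exp 1 * towerV D τ Nt * (exp 1 * (9 * α) / κ ^ 2 * towerV D τ Nt) ^ (N₀ - 1) /
                (1 - exp 1 * (9 * α) / κ ^ 2 * towerV D τ Nt)))) +
          cr * cc ^ (2 * q + 1) * (exp 2 ^ (q + 2) / 2 * towerFO D (κ ^ 2) NF (q + 1))) := by
  have hε : 0 ≤ imagTimeWeight β M := imagTimeWeight_nonneg hβ.le M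
  have h9 : (((9 : ℕ) : ℝ)) = 9 := by norm_num
  have h9α : α ≤ ((9 : ℕ) : ℝ) * α := by rw [h9]; linarith
  have hτ0 : 0 ≤ τ := le_trans (by positivity) hτ1
  -- the full-pin family of the re-keyed instance and its rows
  set B : ℕ → ℕ → ℝ := fun m c => if c = 0 then klTowerMeasLev L M β U μ K d k (2 * m) 0
    else klTowerMeasLev L M β U μ K d k (2 * m) (c + 1) with hB
  have hB0 : ∀ m c, 0 ≤ B m c := fun m c => by
    rw [hB]; dsimp only; split_ifs <;> exact klTowerMeasLev_nonneg hβ.le U μ K d k _ _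
  have hBz : ∀ m, B m 0 = klTowerMeasLev L M β U μ K d k (2 * m) 0 := fun m => by rw [hB]; exact if_pos rfl
  have hNtB' : ∀ m, imagTimeWeight β M * B m 0 ≤ Nt m := fun m => by rw [hBz]; exact hNtB m
  have hNF' : ∀ m c, levelCount Ωe ≤ c + 1 → c ≤ levelCount Ωe → (27 : ℝ) ^ c * (imagTimeWeight β M * B m c) ≤ NF m :=
    fun m c h1 h2 => hNF m c h1 h2
  -- the door guard from the kit guard
  have hnV : normV (SpaceTimeIdx L M × SectorLeg (sectorCount (d * k - 1))) κ ρ (fun m' => imagTimeWeight β M * B m' 0) ≤ towerV D τ Nt :=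
    (normV_mono hκ.le hρ.le hNtB').trans
      ((normV_le_towerV hκ.le hρ.le hNt0 hNt00 hD).trans (towerV_mono (by positivity) hτ2 hNt0 fun _ => le_rfl))
  have hθV : Real.exp 1 * α * normV (SpaceTimeIdx L M × SectorLeg (sectorCount (d * k - 1))) κ ρ
      (fun m' => imagTimeWeight β M * klTowerMeasLev L M β U μ K d k (2 * m') 0) / κ ^ 2 < 1 := by
    have hn0 : 0 ≤ normV (SpaceTimeIdx L M × SectorLeg (sectorCount (d * k - 1))) κ ρ (fun m' => imagTimeWeight β M * B m' 0) :=
      normV_nonneg hκ.le hρ.le fun m' => mul_nonneg hε (hB0 _ _)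
    have hV0 : 0 ≤ towerV D τ Nt := towerV_nonneg (D := D) hτ0 hNt0
    have hfun : (fun m' => imagTimeWeight β M * klTowerMeasLev L M β U μ K d k (2 * m') 0) =
        fun m' => imagTimeWeight β M * B m' 0 := funext fun m' => by rw [hBz]
    rw [hfun]
    calc Real.exp 1 * α * normV (SpaceTimeIdx L M × SectorLeg (sectorCount (d * k - 1))) κ ρ
          (fun m' => imagTimeWeight β M * B m' 0) / κ ^ 2
        = exp 1 / κ ^ 2 * (α * normV (SpaceTimeIdx L M × SectorLeg (sectorCount (d * k - 1))) κ ρ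
            (fun m' => imagTimeWeight β M * B m' 0)) := by ring
      _ ≤ exp 1 / κ ^ 2 * ((9 * α) * towerV D τ Nt) :=
          mul_le_mul_of_nonneg_left (mul_le_mul (by linarith) hnV hn0 (by positivity)) (by positivity)
      _ = exp 1 * (9 * α) / κ ^ 2 * towerV D τ Nt := by ring
      _ < 1 := hguard
  have hguard' : exp 1 * (((9 : ℕ) : ℝ) * α) / κ ^ 2 * towerV D τ Nt < 1 := by rw [h9]; exact hguard
  -- the generic kit composition on k3c2-p3's pin-credited door form
  have h := klLevNormOf_le_kit_oriented_of_doorForm_at (L := L) (M := M) hβ.le μ K (J' := J') (n₁ := d * k - 1) (by omega)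
    (klEffectiveAction L M β U μ K klE0 j - klTowerInput L M β U μ K d k) hκ hρ hα.le h9α hcr0 hcc0 hN₀ (B := B) hB0
    (Bm := fun m : ℕ => imagTimeWeight β M * klTowerMuLevF L M β U μ K d k m * klLevUnitF β M 0 m (d * k - 1) / 27)
    (fun m => towerBmF_nonneg hβ U μ K d k m) (towerBmF_zero β U μ K d k)
    (θ := (1 / 2 : ℝ) ^ (d * k - 1)) (by positivity) (pow_le_one₀ (by norm_num) (by norm_num))
    Ωe hNt0 hNt00 hNtB' hNF' hD hτ1 hτ2 hψ1 hψ2 hguard'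
    (fun p J hp τ'' w'' => doorSum_partialIncr_le_orientedF9' (L := L) (M := M) hβ U μ K hd hk hj hJ' hZ hκ hGB hα hrow hcol hρ hcc0
      hrow' hcol' hN₀ hθV p J hp τ'' w'')
  rw [h9] at h
  exact h


end Born

end Summit.HubbardSuperconductivity.HubbardSuperconductivity.Theorems.EngineV8

end
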